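import Summits.QuantumFields.YangMills.Theorems.BalabanUVNodesN19ShiftedFejerKernel
import Mathlib.Algebra.Polynomial.Eval.Degree

/-!
# YM-DAG node N19 (= NE7 proper) — THE LOWER SIDE OF THE KINK, PART 2: `E_t(|x|) ≥ 1∕(π(9t+6))` (Bernstein's lower half) and
# `E_t(Σ_{k≤n₀}(−1)^k a^{2k+1}|x|^{2k+1}∕(2k+1)!) ≥ a∕(π(9t+6))` by the Fejér-shifted annihilating functional

Cell `pub-ymgap`, HUMAN RULING D-0062 (Track A) ∕ D-0149 (work-bound push), R141 (C) wider-strategy seat `pub-ymgap-dag-n19-e` (strategy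
s3 = ALTERNATIVE CURRENCY), generation g31, module 2 (lineage module 133).  Route `Summits/QuantumFields/YangMills/Theses/BalabanUVNodes.lean`,
cluster item K3⁸ «SpineGivenEndpointR13SepCoPHV» (stmt-QuantumFields-27366); filed `--supports` that item `--as helper` (it proves no registered
stub).  COUNT-NEUTRAL: [folklore] one-dimensional approximation theory over Mathlib (`intervalIntegral`, `Polynomial`) and PART 1
`…N19ShiftedFejerKernel` BY NAME; no laws, no scheme object, no Theses import; NOT a discharge claim.

THE DEVICE [folklore; de la Vallée-Poussin ∕ Fejér].  With PART 1's kernel `D(u) = Σ_{j,j'≤m} cos((T+m+j−j')u) = cos((T+m)u)·F(u)`,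
`F = (Σ_j cos ju)² + (Σ_j sin ju)² ≥ 0`, put `Λ(g) = ∫_0^π ½(g(sin u) + g(−sin u))·D(u) du` (a signed measure on `[−1,1]` of total mass `≤ π(m+1)`
annihilating `Π_{T−1}`):
(i) §3 `abs_functional_le`: `|Λ(g)| ≤ M·π(m+1)` whenever `|g| ≤ M` on `[−1,1]` (`|D| ≤ F`, `∫_0^π F = π(m+1)`);
(ii) §3 `functional_polynomial_eq_zero`: `Λ(p) = 0` for every real polynomial `p` of degree `< T` (odd monomials die under the symmetrisation,
even ones `sin^{2k}` have `J(2k, L) = 0` for every kernel frequency `L ≥ T > 2k`; `integral_symmPow_mul_cos_eq_zero`);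
(iii) §3 `functional_oddPowerSum_eq`: on `f(x) = Σ_{k≤n₀}(−1)^k a^{2k+1}|x|^{2k+1}∕(2k+1)!` (`2n₀+2 ≤ T`),
`Λ(f) = −Σ_{j,j'}Σ_k a^{2k+1}(1 + cos πL_{jj'})∕∏_{i≤k}(L_{jj'}² − (2i+1)²)` — EVERY term of the triple sum has the same sign (PART 1's closed form),
so `−Λ(f) ≥` its `k = 0` part `≥ a·((m+1)² − 1)∕((T+2m)² − 1)` (`D(π) ≥ −1`).  With `m = t`, `T = t+1`: `−Λ(f) ≥ a(t+2)∕(9t+6)` against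
`|Λ(f − p)| ≤ sup|f − p|·π(t+1)`:
★★★ `exists_le_abs_oddPowerSum_sub_eval` — for `t ≥ 1`, `2n₀+1 ≤ t`, `a ≥ 0` and every real polynomial `p` of degree `≤ t` there is
`x ∈ [−1,1]` with `|Σ_{k≤n₀}(−1)^k a^{2k+1}|x|^{2k+1}∕(2k+1)! − p(x)| ≥ a∕(π(9t+6))` (the truncated `sin(a|x|)`; PART 3 adds the Taylor tail and
the cube faces); ★★★ `exists_le_abs_abs_sub_eval` — **`E_t(|x|) ≥ 1∕(π(9t+6))` for every `t ≥ 1`** (S. N. Bernstein 1914: `E_t(|x|) ~ 0.2802∕t`;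
the lower half was not in the tree — `Literature/Analysis/Approximation/AlternationBestApproximation` has the alternation bound, no kink);
★★ `exists_le_abs_mul_abs_sub_eval` (`E_t(a|x|) ≥ a∕(π(9t+6))`).

HONEST FRAMING (binding).  Elementary and [folklore]; NO consumer in the DAG today (the lower side of an optimality map of the seat's own
currency, degree model); nothing of Bałaban's instantiated; NE7 NOT PRINTED, NOT proved; N19 NOT discharged; count-neutral.  One finite `T⁴`
programme at fixed `ε`; nothing continuum ∕ `ℝ⁴` ∕ OS ∕ mass-gap ∕ Clay.  Constants not optimised (`1∕(9π) ≈ 0.035` against `0.2802`).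
0 `def` ∕ 0 `sorry`.
-/

noncomputable section

open Finset Real MeasureTheory intervalIntegral Polynomial

namespace Summit.QuantumFields.YangMills.Theorems.BalabanUVNodesN19KinkLowerBound

open Summit.QuantumFields.YangMills.Theorems.BalabanUVNodesN19ShiftedFejerKernel

/-! ## §3 The functional `Λ(g) = ∫_0^π ½(g(sin u) + g(−sin u))·D(u) du` [folklore] -/

/-- **BOUNDEDNESS.**  If `|g| ≤ M` on `[−1,1]` (and `g` is continuous) then `|Λ(g)| ≤ M·π(m+1)`. [folklore] -/
theorem abs_functional_le (T m : ℕ) {g : ℝ → ℝ} {M : ℝ}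
    (hM : ∀ x ∈ Set.Icc (-1 : ℝ) 1, |g x| ≤ M) :
    |∫ u in (0 : ℝ)..π, (g (Real.sin u) + g (-Real.sin u)) / 2 *
        ∑ j ∈ range (m + 1), ∑ j' ∈ range (m + 1), Real.cos (((T + m + j - j' : ℕ) : ℝ) * u)| ≤
      M * (π * (m + 1)) := by
  have hM0 : 0 ≤ M := (abs_nonneg _).trans (hM 0 (by norm_num))
  rw [← integral_fejerFactor m, ← intervalIntegral.integral_const_mul, ← Real.norm_eq_abs]
  refine intervalIntegral.norm_integral_le_of_norm_le Real.pi_pos.le (Filter.Eventually.of_forall fun u _ => ?_)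
    ((by fun_prop : Continuous fun s : ℝ => M * ((∑ j ∈ range (m + 1), Real.cos (j * s)) ^ 2 +
      (∑ j ∈ range (m + 1), Real.sin (j * s)) ^ 2)).intervalIntegrable _ _)
  rw [Real.norm_eq_abs, abs_mul]
  have h1 : |(g (Real.sin u) + g (-Real.sin u)) / 2| ≤ M := by
    rw [abs_div, abs_two]
    have ha := hM (Real.sin u) (Real.sin_mem_Icc u)
    have hb : |g (-Real.sin u)| ≤ M := hM (-Real.sin u) (by
      have := Real.sin_mem_Icc u
      simp only [Set.mem_Icc] at this ⊢
      constructor <;> linarith [this.1, this.2])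
    have := abs_add_le (g (Real.sin u)) (g (-Real.sin u))
    linarith
  exact mul_le_mul h1 (abs_doubleCosSum_le T m u) (abs_nonneg _) hM0

/-- Symmetrised monomials below the frequency are annihilated: `∫_0^π ½(sin^n u + (−sin u)^n)·cos(Lu) du = 0` for `n < L`. [folklore] -/
theorem integral_symmPow_mul_cos_eq_zero {n L : ℕ} (hnL : n < L) :
    ∫ u in (0 : ℝ)..π, (Real.sin u ^ n + (-Real.sin u) ^ n) / 2 * Real.cos (L * u) = 0 := by
  rcases Nat.even_or_odd n with ⟨k, hk⟩ | ⟨k, hk⟩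
  · subst hk
    have h := integral_sin_pow_even_mul_cos_eq_zero k (L := L) (by omega)
    refine Eq.trans (intervalIntegral.integral_congr fun u _ => ?_) h
    have : (-Real.sin u) ^ (k + k) = Real.sin u ^ (k + k) := Even.neg_pow ⟨k, rfl⟩ _
    rw [this]
    ring
  · subst hk
    have h0 : ∀ u : ℝ, (Real.sin u ^ (2 * k + 1) + (-Real.sin u) ^ (2 * k + 1)) / 2 * Real.cos (L * u) = 0 := by
      intro u
      rw [Odd.neg_pow ⟨k, rfl⟩]
      ring
    simp_rw [h0, intervalIntegral.integral_zero]

/-- **ANNIHILATION.**  `Λ(p) = 0` for every real polynomial `p` of degree `< T`. [folklore] -/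
theorem functional_polynomial_eq_zero {T : ℕ} (m : ℕ) {p : ℝ[X]} (hp : p.natDegree < T) :
    ∫ u in (0 : ℝ)..π, (p.eval (Real.sin u) + p.eval (-Real.sin u)) / 2 *
        ∑ j ∈ range (m + 1), ∑ j' ∈ range (m + 1), Real.cos (((T + m + j - j' : ℕ) : ℝ) * u) = 0 := by
  -- expand the polynomial and the kernel
  have hexp : ∀ u : ℝ, (p.eval (Real.sin u) + p.eval (-Real.sin u)) / 2 *
      ∑ j ∈ range (m + 1), ∑ j' ∈ range (m + 1), Real.cos (((T + m + j - j' : ℕ) : ℝ) * u) =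
      ∑ j ∈ range (m + 1), ∑ j' ∈ range (m + 1), ∑ n ∈ range (p.natDegree + 1),
        p.coeff n * ((Real.sin u ^ n + (-Real.sin u) ^ n) / 2 * Real.cos (((T + m + j - j' : ℕ) : ℝ) * u)) := by
    intro u
    rw [Polynomial.eval_eq_sum_range, Polynomial.eval_eq_sum_range, Finset.mul_sum]
    refine Finset.sum_congr rfl fun j _ => ?_
    rw [Finset.mul_sum]
    refine Finset.sum_congr rfl fun j' _ => ?_
    rw [← Finset.sum_add_distrib, Finset.sum_div, Finset.sum_mul]
    refine Finset.sum_congr rfl fun n _ => ?_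
    ring
  simp_rw [hexp]
  have hint : ∀ (n : ℕ) (c : ℝ), IntervalIntegrable
      (fun u : ℝ => p.coeff n * ((Real.sin u ^ n + (-Real.sin u) ^ n) / 2 * Real.cos (c * u))) volume 0 π :=
    fun n c => (by fun_prop : Continuous fun u : ℝ =>
      p.coeff n * ((Real.sin u ^ n + (-Real.sin u) ^ n) / 2 * Real.cos (c * u))).intervalIntegrable _ _
  rw [intervalIntegral.integral_finsetSum fun j _ => (by fun_prop : Continuous fun u : ℝ =>
    ∑ j' ∈ range (m + 1), ∑ n ∈ range (p.natDegree + 1),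
      p.coeff n * ((Real.sin u ^ n + (-Real.sin u) ^ n) / 2 *
        Real.cos (((T + m + j - j' : ℕ) : ℝ) * u))).intervalIntegrable _ _]
  refine Finset.sum_eq_zero fun j hj => ?_
  rw [intervalIntegral.integral_finsetSum fun j' _ => (by fun_prop : Continuous fun u : ℝ =>
    ∑ n ∈ range (p.natDegree + 1), p.coeff n * ((Real.sin u ^ n + (-Real.sin u) ^ n) / 2 *
      Real.cos (((T + m + j - j' : ℕ) : ℝ) * u))).intervalIntegrable _ _]
  refine Finset.sum_eq_zero fun j' hj' => ?_
  rw [intervalIntegral.integral_finsetSum fun n _ => hint n _]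
  refine Finset.sum_eq_zero fun n hn => ?_
  have hn' : n < T + m + j - j' := by
    have := Finset.mem_range.1 hn
    have := Finset.mem_range.1 hj'
    omega
  rw [intervalIntegral.integral_const_mul, integral_symmPow_mul_cos_eq_zero hn', mul_zero]

/-- **THE SIGN-COHERENT EVALUATION** on the odd-power sums `f(x) = Σ_{k≤n₀}(−1)^k a^{2k+1}|x|^{2k+1}∕(2k+1)!` (`2n₀+2 ≤ T`):
`Λ(f) = −Σ_{j,j'≤m}Σ_{k≤n₀} a^{2k+1}(1 + cos πL_{jj'})∕∏_{i≤k}(L_{jj'}² − (2i+1)²)`, `L_{jj'} = T+m+j−j'`. [folklore] -/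
theorem functional_oddPowerSum_eq {T n₀ : ℕ} (m : ℕ) (hT : 2 * n₀ + 2 ≤ T) (a : ℝ) :
    ∫ u in (0 : ℝ)..π,
        ((∑ k ∈ range (n₀ + 1), (-1) ^ k * a ^ (2 * k + 1) / ((2 * k + 1).factorial : ℝ) *
            |Real.sin u| ^ (2 * k + 1)) +
          (∑ k ∈ range (n₀ + 1), (-1) ^ k * a ^ (2 * k + 1) / ((2 * k + 1).factorial : ℝ) *
            |-Real.sin u| ^ (2 * k + 1))) / 2 *
        ∑ j ∈ range (m + 1), ∑ j' ∈ range (m + 1), Real.cos (((T + m + j - j' : ℕ) : ℝ) * u) =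
      -∑ j ∈ range (m + 1), ∑ j' ∈ range (m + 1), ∑ k ∈ range (n₀ + 1),
        a ^ (2 * k + 1) * (1 + Real.cos (π * ((T + m + j - j' : ℕ) : ℝ))) /
          ∏ i ∈ range (k + 1), ((((T + m + j - j' : ℕ) : ℝ)) ^ 2 - (2 * i + 1) ^ 2) := by
  -- on `[0, π]`, `|±sin u| = sin u`; expand
  have hint : ∀ (k : ℕ) (c : ℝ), IntervalIntegrable
      (fun u : ℝ => (-1) ^ k * a ^ (2 * k + 1) / ((2 * k + 1).factorial : ℝ) *
        (Real.sin u ^ (2 * k + 1) * Real.cos (c * u))) volume 0 π :=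
    fun k c => ((intervalIntegrable_sin_pow_mul_cos (2 * k + 1) c 0 π).const_mul _)
  have hcongr : ∫ u in (0 : ℝ)..π,
      ((∑ k ∈ range (n₀ + 1), (-1) ^ k * a ^ (2 * k + 1) / ((2 * k + 1).factorial : ℝ) *
            |Real.sin u| ^ (2 * k + 1)) +
          (∑ k ∈ range (n₀ + 1), (-1) ^ k * a ^ (2 * k + 1) / ((2 * k + 1).factorial : ℝ) *
            |-Real.sin u| ^ (2 * k + 1))) / 2 *
        ∑ j ∈ range (m + 1), ∑ j' ∈ range (m + 1), Real.cos (((T + m + j - j' : ℕ) : ℝ) * u) =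
      ∫ u in (0 : ℝ)..π, ∑ j ∈ range (m + 1), ∑ j' ∈ range (m + 1), ∑ k ∈ range (n₀ + 1),
        (-1) ^ k * a ^ (2 * k + 1) / ((2 * k + 1).factorial : ℝ) *
          (Real.sin u ^ (2 * k + 1) * Real.cos (((T + m + j - j' : ℕ) : ℝ) * u)) := by
    refine intervalIntegral.integral_congr fun u hu => ?_
    have hu' : u ∈ Set.Icc 0 π := by simpa [Set.uIcc_of_le Real.pi_pos.le] using hu
    have hs : |Real.sin u| = Real.sin u := abs_of_nonneg (Real.sin_nonneg_of_nonneg_of_le_pi hu'.1 hu'.2)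
    simp only [abs_neg, hs]
    rw [show (∑ k ∈ range (n₀ + 1), (-1) ^ k * a ^ (2 * k + 1) / ((2 * k + 1).factorial : ℝ) *
        Real.sin u ^ (2 * k + 1) +
        ∑ k ∈ range (n₀ + 1), (-1) ^ k * a ^ (2 * k + 1) / ((2 * k + 1).factorial : ℝ) *
          Real.sin u ^ (2 * k + 1)) / 2 =
        ∑ k ∈ range (n₀ + 1), (-1) ^ k * a ^ (2 * k + 1) / ((2 * k + 1).factorial : ℝ) *
          Real.sin u ^ (2 * k + 1) by ring, Finset.mul_sum]
    refine Finset.sum_congr rfl fun j _ => ?_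
    rw [Finset.mul_sum]
    refine Finset.sum_congr rfl fun j' _ => ?_
    rw [Finset.sum_mul]
    refine Finset.sum_congr rfl fun k _ => ?_
    ring
  rw [hcongr, intervalIntegral.integral_finsetSum fun j _ => (by fun_prop : Continuous fun u : ℝ =>
    ∑ j' ∈ range (m + 1), ∑ k ∈ range (n₀ + 1),
      (-1) ^ k * a ^ (2 * k + 1) / ((2 * k + 1).factorial : ℝ) *
        (Real.sin u ^ (2 * k + 1) * Real.cos (((T + m + j - j' : ℕ) : ℝ) * u))).intervalIntegrable _ _,
    ← Finset.sum_neg_distrib]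
  refine Finset.sum_congr rfl fun j hj => ?_
  rw [intervalIntegral.integral_finsetSum fun j' _ => (by fun_prop : Continuous fun u : ℝ =>
    ∑ k ∈ range (n₀ + 1), (-1) ^ k * a ^ (2 * k + 1) / ((2 * k + 1).factorial : ℝ) *
      (Real.sin u ^ (2 * k + 1) * Real.cos (((T + m + j - j' : ℕ) : ℝ) * u))).intervalIntegrable _ _,
    ← Finset.sum_neg_distrib]
  refine Finset.sum_congr rfl fun j' hj' => ?_
  rw [intervalIntegral.integral_finsetSum fun k _ => hint k _, ← Finset.sum_neg_distrib]
  refine Finset.sum_congr rfl fun k hk => ?_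
  have hk' : k ≤ n₀ := Nat.lt_succ_iff.1 (Finset.mem_range.1 hk)
  have hL : 2 * k + 2 ≤ T + m + j - j' := by
    have := Finset.mem_range.1 hj'
    omega
  rw [intervalIntegral.integral_const_mul, integral_sin_pow_odd_mul_cos k hL]
  have hfact : ((2 * k + 1).factorial : ℝ) ≠ 0 := by positivity
  have hprod := (prod_sq_sub_odd_sq_pos k hL).ne'
  have hsign : ((-1 : ℝ) ^ k) * (-1) ^ (k + 1) = -1 := by
    rw [pow_succ, ← mul_assoc, ← mul_pow]; simp
  field_simp
  linear_combination a ^ (2 * k + 1) * (1 + Real.cos (π * ((T + m + j - j' : ℕ) : ℝ))) * hsign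

/-! ## §4 The lower bounds [folklore] -/

/-- **THE ODD-POWER SUMS** (the truncated sine of a kink).  For `t ≥ 1`, `2n₀+1 ≤ t`, `a ≥ 0` and every real polynomial `p` of degree
`≤ t` there is `x ∈ [−1,1]` with `|Σ_{k≤n₀}(−1)^k a^{2k+1}|x|^{2k+1}∕(2k+1)! − p(x)| ≥ a∕(π(9t+6))`. [folklore] -/
theorem exists_le_abs_oddPowerSum_sub_eval {t n₀ : ℕ} (ht : 1 ≤ t) (hn₀ : 2 * n₀ + 1 ≤ t) {a : ℝ} (ha : 0 ≤ a)
    (p : ℝ[X]) (hp : p.natDegree ≤ t) :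
    ∃ x ∈ Set.Icc (-1 : ℝ) 1, a / (π * (9 * t + 6)) ≤
      |(∑ k ∈ range (n₀ + 1), (-1) ^ k * a ^ (2 * k + 1) / ((2 * k + 1).factorial : ℝ) * |x| ^ (2 * k + 1)) -
        p.eval x| := by
  rcases ha.eq_or_lt with ha0 | ha0
  · exact ⟨0, by norm_num, by rw [← ha0]; simp⟩
  by_contra H
  push Not at H
  -- abbreviations
  set f : ℝ → ℝ := fun x => ∑ k ∈ range (n₀ + 1),
    (-1) ^ k * a ^ (2 * k + 1) / ((2 * k + 1).factorial : ℝ) * |x| ^ (2 * k + 1) with hf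
  set D : ℝ → ℝ := fun u => ∑ j ∈ range (t + 1), ∑ j' ∈ range (t + 1),
    Real.cos ((((t + 1) + t + j - j' : ℕ) : ℝ) * u) with hD
  set c : ℝ := a / (π * (9 * t + 6)) with hc
  have ht0 : (0 : ℝ) < t := by exact_mod_cast ht
  have hfc : Continuous f := by fun_prop
  have hDc : Continuous D := by fun_prop
  have hgc : Continuous fun x => f x - p.eval x := hfc.sub (Polynomial.continuous p)
  -- (i) boundedness on the difference
  have hbound := abs_functional_le (t + 1) t (g := fun x => f x - p.eval x) (M := c) fun x hx => (H x hx).le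
  -- (ii) linearity + annihilation of `p`
  have hsplit : ∫ u in (0 : ℝ)..π, ((f (Real.sin u) - p.eval (Real.sin u)) +
      (f (-Real.sin u) - p.eval (-Real.sin u))) / 2 * D u =
      (∫ u in (0 : ℝ)..π, (f (Real.sin u) + f (-Real.sin u)) / 2 * D u) -
        ∫ u in (0 : ℝ)..π, (p.eval (Real.sin u) + p.eval (-Real.sin u)) / 2 * D u := by
    rw [← intervalIntegral.integral_sub]
    · exact intervalIntegral.integral_congr fun u _ => by ring
    · exact (by fun_prop : Continuous fun u => (f (Real.sin u) + f (-Real.sin u)) / 2 * D u).intervalIntegrable _ _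
    · exact ((Polynomial.continuous p).comp Real.continuous_sin |>.add
        ((Polynomial.continuous p).comp Real.continuous_sin.neg) |>.div_const 2 |>.mul hDc).intervalIntegrable _ _
  have hpoly := functional_polynomial_eq_zero (T := t + 1) t (p := p) (Nat.lt_succ_of_le hp)
  -- (iii) the sign-coherent evaluation
  have heval := functional_oddPowerSum_eq (T := t + 1) t (by omega : 2 * n₀ + 2 ≤ t + 1) a
  -- (iv) the main term
  set S : ℝ := ∑ j ∈ range (t + 1), ∑ j' ∈ range (t + 1), ∑ k ∈ range (n₀ + 1),
    a ^ (2 * k + 1) * (1 + Real.cos (π * (((t + 1) + t + j - j' : ℕ) : ℝ))) /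
      ∏ i ∈ range (k + 1), (((((t + 1) + t + j - j' : ℕ) : ℝ)) ^ 2 - (2 * i + 1) ^ 2) with hS
  have hS_lower : a * (((t : ℝ) + 1) ^ 2 - 1) / ((3 * t + 1) ^ 2 - 1) ≤ S := by
    have hden : (0 : ℝ) < (3 * t + 1) ^ 2 - 1 := by nlinarith
    -- each (j,j') contributes at least its `k = 0` term, itself at least `a(1+cos)/((3t+1)²−1)`
    have hjj : ∀ j ∈ range (t + 1), ∀ j' ∈ range (t + 1),
        a * (1 + Real.cos (π * (((t + 1) + t + j - j' : ℕ) : ℝ))) / ((3 * t + 1) ^ 2 - 1) ≤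
          ∑ k ∈ range (n₀ + 1), a ^ (2 * k + 1) * (1 + Real.cos (π * (((t + 1) + t + j - j' : ℕ) : ℝ))) /
            ∏ i ∈ range (k + 1), (((((t + 1) + t + j - j' : ℕ) : ℝ)) ^ 2 - (2 * i + 1) ^ 2) := by
      intro j hj j' hj'
      have hjm := Finset.mem_range.1 hj
      have hjm' := Finset.mem_range.1 hj'
      have hcos : 0 ≤ 1 + Real.cos (π * (((t + 1) + t + j - j' : ℕ) : ℝ)) := by
        linarith [Real.neg_one_le_cos (π * (((t + 1) + t + j - j' : ℕ) : ℝ))]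
      have hL1 : (2 : ℝ) ≤ (((t + 1) + t + j - j' : ℕ) : ℝ) := by
        exact_mod_cast (show 2 ≤ (t + 1) + t + j - j' by omega)
      have hL2 : (((t + 1) + t + j - j' : ℕ) : ℝ) ≤ 3 * t + 1 := by
        exact_mod_cast (show (t + 1) + t + j - j' ≤ 3 * t + 1 by omega)
      calc a * (1 + Real.cos (π * (((t + 1) + t + j - j' : ℕ) : ℝ))) / ((3 * t + 1) ^ 2 - 1)
          ≤ a * (1 + Real.cos (π * (((t + 1) + t + j - j' : ℕ) : ℝ))) /
              ((((t + 1) + t + j - j' : ℕ) : ℝ) ^ 2 - 1) := by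
            refine div_le_div_of_nonneg_left (mul_nonneg ha hcos) (by nlinarith) (by nlinarith)
        _ = a ^ (2 * 0 + 1) * (1 + Real.cos (π * (((t + 1) + t + j - j' : ℕ) : ℝ))) /
              ∏ i ∈ range (0 + 1), (((((t + 1) + t + j - j' : ℕ) : ℝ)) ^ 2 - (2 * i + 1) ^ 2) := by
            simp
        _ ≤ _ := by
            refine Finset.single_le_sum (f := fun k => a ^ (2 * k + 1) *
              (1 + Real.cos (π * (((t + 1) + t + j - j' : ℕ) : ℝ))) /
              ∏ i ∈ range (k + 1), (((((t + 1) + t + j - j' : ℕ) : ℝ)) ^ 2 - (2 * i + 1) ^ 2))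
              (fun k hk => ?_) (Finset.mem_range.2 (Nat.succ_pos n₀))
            have hk' : k ≤ n₀ := Nat.lt_succ_iff.1 (Finset.mem_range.1 hk)
            exact div_nonneg (mul_nonneg (pow_nonneg ha _) hcos)
              (prod_sq_sub_odd_sq_pos k (L := (t + 1) + t + j - j') (by omega)).le
    calc a * (((t : ℝ) + 1) ^ 2 - 1) / ((3 * t + 1) ^ 2 - 1)
        ≤ ∑ j ∈ range (t + 1), ∑ j' ∈ range (t + 1),
            a * (1 + Real.cos (π * (((t + 1) + t + j - j' : ℕ) : ℝ))) / ((3 * t + 1) ^ 2 - 1) := by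
          have hDpi := neg_one_le_doubleCosSum_pi (t + 1) t
          have hcount : ∑ j ∈ range (t + 1), ∑ j' ∈ range (t + 1),
              (1 + Real.cos (π * (((t + 1) + t + j - j' : ℕ) : ℝ))) =
              ((t : ℝ) + 1) ^ 2 + ∑ j ∈ range (t + 1), ∑ j' ∈ range (t + 1),
                Real.cos ((((t + 1) + t + j - j' : ℕ) : ℝ) * π) := by
            simp only [Finset.sum_add_distrib, Finset.sum_const, Finset.card_range, nsmul_eq_mul, mul_comm π]
            push_cast
            ring
          have hinner : ((t : ℝ) + 1) ^ 2 - 1 ≤ ∑ j ∈ range (t + 1), ∑ j' ∈ range (t + 1),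
              (1 + Real.cos (π * (((t + 1) + t + j - j' : ℕ) : ℝ))) := by
            rw [hcount]
            linarith
          calc a * (((t : ℝ) + 1) ^ 2 - 1) / ((3 * t + 1) ^ 2 - 1)
              ≤ a * (∑ j ∈ range (t + 1), ∑ j' ∈ range (t + 1),
                  (1 + Real.cos (π * (((t + 1) + t + j - j' : ℕ) : ℝ)))) / ((3 * t + 1) ^ 2 - 1) :=
                div_le_div_of_nonneg_right (mul_le_mul_of_nonneg_left hinner ha) hden.le
            _ = _ := by
                rw [Finset.mul_sum, Finset.sum_div]
                refine Finset.sum_congr rfl fun j _ => ?_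
                rw [Finset.mul_sum, Finset.sum_div]
      _ ≤ S := Finset.sum_le_sum fun j hj => Finset.sum_le_sum fun j' hj' => hjj j hj j' hj'
  -- (v) assemble the contradiction
  have hkey : (∫ u in (0 : ℝ)..π, ((f (Real.sin u) - p.eval (Real.sin u)) +
      (f (-Real.sin u) - p.eval (-Real.sin u))) / 2 * D u) = -S := by
    rw [hsplit, hpoly, sub_zero, hf, hD]
    exact heval
  rw [hkey, abs_neg] at hbound
  have hSabs : S ≤ |S| := le_abs_self S
  have h1 : a * (((t : ℝ) + 1) ^ 2 - 1) / ((3 * t + 1) ^ 2 - 1) = a * (t + 2) / (9 * t + 6) := by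
    rw [div_eq_div_iff (by nlinarith) (by nlinarith)]
    ring
  have h2 : c * (π * (t + 1)) = a * (t + 1) / (9 * t + 6) := by
    rw [hc]
    field_simp
  rw [h2] at hbound
  rw [h1] at hS_lower
  have h3 : a * (t + 2) / (9 * t + 6) ≤ a * (t + 1) / (9 * t + 6) := hS_lower.trans (hSabs.trans hbound)
  rw [div_le_div_iff_of_pos_right (by nlinarith)] at h3
  nlinarith

/-- ★★★ **BERNSTEIN'S LOWER HALF FOR `|x|`.**  For every `t ≥ 1` and every real polynomial `p` of degree `≤ t` there is
`x ∈ [−1,1]` with `||x| − p(x)| ≥ 1∕(π(9t+6))`, i.e. `E_t(|x|) ≥ 1∕(π(9t+6))` (Bernstein 1914: `E_t(|x|) ~ 0.2802∕t`). [folklore] -/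
theorem exists_le_abs_abs_sub_eval {t : ℕ} (ht : 1 ≤ t) (p : ℝ[X]) (hp : p.natDegree ≤ t) :
    ∃ x ∈ Set.Icc (-1 : ℝ) 1, 1 / (π * (9 * t + 6)) ≤ |(|x|) - p.eval x| := by
  obtain ⟨x, hx, h⟩ := exists_le_abs_oddPowerSum_sub_eval (n₀ := 0) ht (by omega) zero_le_one p hp
  refine ⟨x, hx, ?_⟩
  simpa using h

/-- ★★ **THE SCALED KINK `a|x|`**: `E_t(a|x|) ≥ a∕(π(9t+6))` for `a ≥ 0`, `t ≥ 1`. [folklore] -/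
theorem exists_le_abs_mul_abs_sub_eval {t : ℕ} (ht : 1 ≤ t) {a : ℝ} (ha : 0 ≤ a) (p : ℝ[X])
    (hp : p.natDegree ≤ t) :
    ∃ x ∈ Set.Icc (-1 : ℝ) 1, a / (π * (9 * t + 6)) ≤ |a * |x| - p.eval x| := by
  obtain ⟨x, hx, h⟩ := exists_le_abs_oddPowerSum_sub_eval (n₀ := 0) ht (by omega) ha p hp
  refine ⟨x, hx, ?_⟩
  simpa using h

end Summit.QuantumFields.YangMills.Theorems.BalabanUVNodesN19KinkLowerBound

end
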